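import Summits.SmoothPoincare4.SmoothPoincare4.Theorems.SymplecticOrigamiOrigamiFoldExistenceStubOuterCleanRecognitionChartPsi

/-!
# Stub `stub_outerSideLemma` of line `shadow-pleats` for crux `OrigamiFoldExistence` — β:
# the structure map `Ψ` is a LOCAL HOMEOMORPHISM off the closed chart ball
(item stmt-SmoothPoincare4-7844, route SymplecticOrigami; seat c5, complementary lead on O1)

For a `1`-chart pleated round-rim position `(ι, δ, e)` (`IsPleatedPosition ι δ e`) and an abstract cap map
`C : ℝ⁵ → S⁴` (smooth where `p₄ < 1`, equal to `λ ∘ proj5` on the band, differential injective on tangent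
directions at cap points — the hypotheses of file Q `…StubOuterCleanRecognitionChartPsi`), the structure map
`Ψ = psiMap ι δ C : M → S⁴` is a local homeomorphism at every point off the closed chart ball `e 0 '' B̄₂`:

* `isLocalHomeomorphOn_psiMap` — `IsLocalHomeomorphOn Ψ {m | m ∉ e 0 '' closedBall 0 2}`;
* `isLocalHomeomorphOn_restrict_psiMap` — the same for `Ψ` restricted to the subtype
  `K = {m | m ∉ e 0 '' ball 0 2}`, at the points of `K° = {m | m ∉ e 0 '' closedBall 0 2}`.

Proof.  Off `e 0 '' B̄₂` a point `m` misses `e 0 '' B_R` for some `R > 2` (`R = ‖u‖` if `m = e 0 u`,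
`R = 3` otherwise), and the fold spheres `e 0 '' (S₁ ∪ S₂)` lie in `e 0 '' B_R`; so clause 7 of
`IsPleatedPosition` makes the shadow immersive above the plane off `e 0 '' B_R`, file Q's
`injective_mfderiv_psiMap` / `contMDiff_psiMap` make `Ψ` a smooth immersion of `4`-manifolds at `m`, the
inverse function theorem (tree `isLocalDiffeomorphAt_of_injective_mfderiv_four` of
`…StubPleatFreeStandardShadow`) makes it a local diffeomorphism there, and Mathlib's
`IsLocalDiffeomorphOn.isLocalHomeomorphOn` a local homeomorphism.  For the subtype form, `M` is Hausdorff
(it embeds in `ℝ⁵` by `ι`), so `e 0 '' B̄₂` is compact hence closed, `K°` is open and contained in `K`, the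
inclusion `K → M` is a local homeomorphism at the points of `K°`, and local homeomorphisms compose.

Why: file ε `…StubOuterSideLemma` shows that `Ψ|K` is a covering map over each open side of the lifted
outer crease by Mathlib's `IsCoveringMapOn.of_isLocalHomeomorphOn` (compact domain); these two theorems
are its local-homeomorphism input.
Sources: J. M. Lee, *Introduction to Smooth Manifolds* (2013), Thm. 4.5; SideLemma-covering-c5.md §1 (Ψ2).
-/

noncomputable section

-- the prescribed namespace `Summit.<P>.<Sub>.…` duplicates `SmoothPoincare4` (P = Sub)
set_option linter.dupNamespace false

open scoped Manifold ContDiff Topology RealInnerProductSpace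
open Set Function Filter Metric
open Literature.Topology.FourManifolds Literature.Topology.FourManifolds.SphereHypersurfaceSides

namespace Summit.SmoothPoincare4.SmoothPoincare4.Theorems.OrigamiFoldExistence.ShadowPleats

section PsiLocal

/-- The inclusion of a subset `K ⊆ X` is a local homeomorphism (as a map `K → X`) at the points of any
open set `t ⊆ K` of `X`: near such a point it is the inclusion of the open set `t`. [folklore] -/
private theorem isLocalHomeomorphOn_subtypeVal {X : Type*} [TopologicalSpace X] {K t : Set X}
    (ht : IsOpen t) (htK : t ⊆ K) :
    IsLocalHomeomorphOn (Subtype.val : K → X) {k : K | (k : X) ∈ t} := by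
  rw [isLocalHomeomorphOn_iff_isOpenEmbedding_restrict]
  intro k hk
  refine ⟨Subtype.val ⁻¹' t, (ht.preimage continuous_subtype_val).mem_nhds hk, ?_⟩
  have hemb : Topology.IsEmbedding ((Subtype.val ⁻¹' t).restrict (Subtype.val : K → X)) :=
    Topology.IsEmbedding.subtypeVal.comp Topology.IsEmbedding.subtypeVal
  refine ⟨hemb, ?_⟩
  rw [Set.range_restrict, Set.image_preimage_eq_inter_range, Subtype.range_coe,
    Set.inter_eq_left.2 htK]
  exact ht

variable {M : Type} [TopologicalSpace M] [ChartedSpace (EuclideanSpace ℝ (Fin 4)) M] [IsManifold (𝓡 4) ∞ M]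
  {ι : M → EuclideanSpace ℝ (Fin 5)} {δ : ℝ} {e : Fin 1 → EuclideanSpace ℝ (Fin 4) → M}
  {C : EuclideanSpace ℝ (Fin 5) → Metric.sphere (0 : EuclideanSpace ℝ (Fin 5)) 1}

/-- **`Ψ` is a local homeomorphism at every point off the closed chart ball `e₀(B̄₂)`** (there it is an
immersion between 4-manifolds: the shadow is immersive above the plane off the fold spheres, which lie in
`e₀(B̄₂)`, and the cap map is immersive on the cap). [folklore] -/
theorem isLocalHomeomorphOn_psiMap (hpos : IsPleatedPosition ι δ e)
    (hCs : ∀ p : EuclideanSpace ℝ (Fin 5), p 4 < 1 →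
      ContMDiffAt 𝓘(ℝ, EuclideanSpace ℝ (Fin 5)) (𝓡 4) ∞ C p)
    (hCband : ∀ p : EuclideanSpace ℝ (Fin 5), ‖p‖ = 1 → (1 - δ) / 2 ≤ p 4 → p 4 < 1 →
      C p = liftS4 (proj5 p))
    (hCd : ∀ p : EuclideanSpace ℝ (Fin 5), ‖p‖ = 1 → p 4 ≤ 1 - δ → ∀ w : EuclideanSpace ℝ (Fin 5),
      ⟪p, w⟫ = 0 → mfderiv 𝓘(ℝ, EuclideanSpace ℝ (Fin 5)) (𝓡 4) C p w = 0 → w = 0) :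
    IsLocalHomeomorphOn (psiMap ι δ C) {m : M | m ∉ e 0 '' Metric.closedBall 0 2} := by
  obtain ⟨hι, hδ, hδ1, hround, hcharts, -, himm, -⟩ := hpos
  -- the fold spheres of the chart lie in `e 0 '' B_R` for every `R > 2`, so the shadow is immersive
  -- above the plane off `e 0 '' B_R`
  have hfold : ∀ R : ℝ, 2 < R → ∀ m : M, 1 - δ < ι m 4 → m ∉ e 0 '' Metric.ball 0 R →
      Injective (mfderiv (𝓡 4) (𝓡 4) (proj5 ∘ ι) m) := by
    intro R hR m hm hmR
    refine himm m hm fun hmem => ?_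
    obtain ⟨j, u, hu, rfl⟩ := Set.mem_iUnion.1 hmem
    obtain rfl : j = 0 := Subsingleton.elim j 0
    refine hmR ⟨u, mem_ball_zero_iff.2 ?_, rfl⟩
    rcases hu with hu | hu <;> rw [mem_sphere_zero_iff_norm.1 hu] <;> linarith
  have hsmooth : ContMDiff (𝓡 4) (𝓡 4) ∞ (psiMap ι δ C) := contMDiff_psiMap hι hδ hδ1 hround hCs hCband
  have hdiff : IsLocalDiffeomorphOn (𝓡 4) (𝓡 4) ∞ (psiMap ι δ C)
      {m : M | m ∉ e 0 '' Metric.closedBall 0 2} := by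
    rintro ⟨m, hm⟩
    -- a radius `R > 2` with `m ∉ e 0 '' B_R`
    obtain ⟨R, hR, hmR⟩ : ∃ R : ℝ, 2 < R ∧ m ∉ e 0 '' Metric.ball 0 R := by
      by_cases hrange : m ∈ Set.range (e 0)
      · obtain ⟨u, rfl⟩ := hrange
        have hu : 2 < ‖u‖ := by
          by_contra hle
          exact hm ⟨u, mem_closedBall_zero_iff.2 (not_lt.1 hle), rfl⟩
        refine ⟨‖u‖, hu, ?_⟩
        rintro ⟨u', hu', hu'u⟩
        obtain rfl : u' = u := (hcharts 0).1.isEmbedding.injective hu'u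
        exact (lt_irrefl _) (mem_ball_zero_iff.1 hu')
      · exact ⟨3, by norm_num, fun ⟨u, _, hu⟩ => hrange ⟨u, hu⟩⟩
    exact isLocalDiffeomorphAt_of_injective_mfderiv_four hsmooth
      (injective_mfderiv_psiMap hι hδ hδ1 hround hCs hCband hCd (hfold R hR) hmR)
  exact hdiff.isLocalHomeomorphOn

/-- **The same for the restriction of `Ψ` to the compact piece `K = M ∖ e₀(B₂)`**, read on the subtype `K`, at
every point of the open part `K° = M ∖ e₀(B̄₂)` of `K` (`M` is Hausdorff since `ι` embeds it in `ℝ⁵`, so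
`e₀(B̄₂)` is closed; near a point of the open set `K° ⊆ K` the inclusion `K → M` is a local homeomorphism, and
local homeomorphisms compose). [folklore] -/
theorem isLocalHomeomorphOn_restrict_psiMap (hpos : IsPleatedPosition ι δ e)
    (hCs : ∀ p : EuclideanSpace ℝ (Fin 5), p 4 < 1 →
      ContMDiffAt 𝓘(ℝ, EuclideanSpace ℝ (Fin 5)) (𝓡 4) ∞ C p)
    (hCband : ∀ p : EuclideanSpace ℝ (Fin 5), ‖p‖ = 1 → (1 - δ) / 2 ≤ p 4 → p 4 < 1 →
      C p = liftS4 (proj5 p))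
    (hCd : ∀ p : EuclideanSpace ℝ (Fin 5), ‖p‖ = 1 → p 4 ≤ 1 - δ → ∀ w : EuclideanSpace ℝ (Fin 5),
      ⟪p, w⟫ = 0 → mfderiv 𝓘(ℝ, EuclideanSpace ℝ (Fin 5)) (𝓡 4) C p w = 0 → w = 0) :
    IsLocalHomeomorphOn (fun k : {m : M | m ∉ e 0 '' Metric.ball 0 2} => psiMap ι δ C k)
      {k | (k : M) ∉ e 0 '' Metric.closedBall 0 2} := by
  have hM := isLocalHomeomorphOn_psiMap hpos hCs hCband hCd
  obtain ⟨hι, -, -, -, hcharts, -, -, -⟩ := hpos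
  haveI : T2Space M := hι.isEmbedding.t2Space
  have hopen : IsOpen {m : M | m ∉ e 0 '' Metric.closedBall 0 2} :=
    (((isCompact_closedBall (0 : EuclideanSpace ℝ (Fin 4)) 2).image
      (hcharts 0).1.contMDiff.continuous).isClosed).isOpen_compl
  have hsub : {m : M | m ∉ e 0 '' Metric.closedBall 0 2} ⊆ {m : M | m ∉ e 0 '' Metric.ball 0 2} :=
    fun m hm hm' => hm (Set.image_mono Metric.ball_subset_closedBall hm')
  exact hM.comp (isLocalHomeomorphOn_subtypeVal hopen hsub) fun k hk => hk

end PsiLocal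

end Summit.SmoothPoincare4.SmoothPoincare4.Theorems.OrigamiFoldExistence.ShadowPleats

end
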